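import Mathlib.MeasureTheory.Measure.Lebesgue.Basic
import Literature.NumberTheory.Transcendental.KZFibredRelations
import Literature.NumberTheory.Transcendental.KZDominatedFamily
import Summits.KontsevichZagierPeriods.KontsevichZagierPeriods.Theorems.ValuedFieldSpecialisationCTConstructionConstantTermOfNormalForm

/-!
# Route ValuedFieldSpecialisation — crux `ParametricLifting` (stmt-KontsevichZagierPeriods-3498),
line `registered`/birth, stub S2c `stub_divergentNetVanishes_of`: THE DIVERGENT NET OF A FIBRED
RELATION VANISHES (composition S2a → S2b → S2)

Given the slice formula of elementary divergent product families (S2a, hypothesis) and the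
vanishing of grouped coefficients of divergent monomials with a limit along a non-trivial filter
finer than `𝓝[>] 0` (S2b, hypothesis): if `H ∈ KZ.fibredRelations` has net `D + N`, `D` elementary
divergent, `N` dominated, then `KZ.sliceEval D s = 0` for every `s ∈ (0,1)` — slices of fibred
relations vanish a.e. (`KZ.sliceEval_ae_eq_zero`), dominated slices converge
(`KZ.IsDominatedFamily.tendsto_setIntegral`), along `𝓝[>] 0 ⊓ ae volume`.
Helper (`--supports`) for item stmt-KontsevichZagierPeriods-3498. [Kontsevich–Zagier 2001, §1.2]
-/

noncomputable section

namespace Summit.KontsevichZagierPeriods.ValuedFieldSpecialisation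

open MeasureTheory Set Filter
open scoped Topology
open Literature.NumberTheory.Transcendental

/-- **The divergent net of a fibred relation vanishes** (crux `ParametricLifting`,
stmt-KontsevichZagierPeriods-3498, line `registered`, stub S2c; composition S2a → S2b → S2).
Hypotheses, verbatim the two neighbouring stubs: (S2a) the slice over `s ∈ (0,1)` of an
elementary divergent product family `P(p,q,b,d,ρ)` is `s^(-p/q) · (-log s)^b · ρ.value`;
(S2b) if a finite real combination `∑ i, w i * s^(a i) * (log s)^(b i)` of divergent monomials
(`a i < 0`, or `a i = 0 < b i`) has a finite limit along a non-trivial filter `l ≤ 𝓝[>] 0`, then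
for every exponent pair the total coefficient `∑_{i : (a i, b i) = (a i₀, b i₀)} w i` is `0`.
Conclusion: if `H ∈ KZ.fibredRelations` is the sum of an elementary divergent net
`D = ∑ i, m i • [P i]` (`0 < q i`, `0 < p i ∨ 0 < b i`) and of a dominated net
`N = ∑ j, m₂ j • [R j]` (`KZ.IsDominatedFamily (R j) (r₀ j) (g j)`), then `KZ.sliceEval D s = 0`
for EVERY `s ∈ (0,1)`. Proof: by additivity of `KZ.sliceEval` and (S2a), on `(0,1)`
`sliceEval D s = ∑ i, w i * s^(a i) * (log s)^(b i)` with `a i = -(p i)/(q i)`,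
`w i = m i * (-1)^(b i) * (ρ i).value`, all monomials divergent; by Lebesgue
(`KZ.IsDominatedFamily.tendsto_setIntegral`) `sliceEval N s → ∑ j, m₂ j * (r₀ j).value` as
`s → 0⁺`; the slices of `H` vanish a.e. (`KZ.sliceEval_ae_eq_zero`), so the set `A` of parameters
with `sliceEval D s + sliceEval N s = 0` is co-null, the filter `𝓝[>] 0 ⊓ 𝓟 A` is non-trivial
(`nhdsGT_inf_principal_neBot_of_volume_compl_eq_zero`) and along it the monomial sum tends to
`-(∑ j, m₂ j * (r₀ j).value)`; (S2b) kills every grouped coefficient, and grouping the monomial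
sum at the given `s` by exponent pairs (`Finset.sum_image'`) gives `0`.
[Kontsevich–Zagier 2001, §1.2; Kaiser 2017, Prop. 4.7; Lebesgue] [folklore] -/
theorem stub_divergentNetVanishes_of :
    (∀ (p q b d : ℕ) (ρ : KZ.IntegralRep d) (P : KZ.IntegralRep (b + d + 1 + 1)), 0 < q → P.domain = {z | ∃ (s u : ℝ) (y : Fin b → ℝ) (w : Fin d → ℝ), z = Matrix.vecCons s (Matrix.vecCons u (Fin.append y w)) ∧ 0 < s ∧ s < 1 ∧ 0 < u ∧ u ^ q * s ^ p < 1 ∧ (∀ j, s ≤ y j ∧ y j ≤ 1) ∧ w ∈ ρ.domain} → (P.integrand = fun z => (∏ j : Fin b, (z (Fin.castAdd d j).succ.succ)⁻¹) * ρ.integrand (fun l : Fin d => z (Fin.natAdd b l).succ.succ)) → ∀ s ∈ Set.Ioo (0 : ℝ) 1, KZ.sliceValue P s = s ^ (-(p / q : ℝ)) * (-Real.log s) ^ b * ρ.value) →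
    (∀ (k : ℕ) (a : Fin k → ℝ) (b : Fin k → ℕ) (w : Fin k → ℝ) (l : Filter ℝ) (c : ℝ), l.NeBot → l ≤ nhdsWithin (0 : ℝ) (Set.Ioi 0) → (∀ i, a i < 0 ∨ (a i = 0 ∧ 0 < b i)) → Filter.Tendsto (fun s : ℝ => ∑ i, w i * s ^ (a i) * Real.log s ^ (b i)) l (nhds c) → ∀ i₀ : Fin k, ∑ i ∈ Finset.univ.filter (fun i => a i = a i₀ ∧ b i = b i₀), w i = 0) →
    ∀ H ∈ KZ.fibredRelations, ∀ (k : ℕ) (m : Fin k → ℤ) (p q b d : Fin k → ℕ) (ρ : (i : Fin k) → KZ.IntegralRep (d i)) (P : (i : Fin k) → KZ.IntegralRep (b i + d i + 1 + 1)) (k₂ : ℕ) (d₂ : Fin k₂ → ℕ) (m₂ : Fin k₂ → ℤ) (R : (j : Fin k₂) → KZ.IntegralRep (d₂ j + 1)) (r₀ g : (j : Fin k₂) → KZ.IntegralRep (d₂ j)), (∀ i, 0 < q i ∧ (0 < p i ∨ 0 < b i) ∧ (P i).domain = {z | ∃ (s u : ℝ) (y : Fin (b i) → ℝ) (w : Fin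 (d i) → ℝ), z = Matrix.vecCons s (Matrix.vecCons u (Fin.append y w)) ∧ 0 < s ∧ s < 1 ∧ 0 < u ∧ u ^ (q i) * s ^ (p i) < 1 ∧ (∀ j, s ≤ y j ∧ y j ≤ 1) ∧ w ∈ (ρ i).domain} ∧ (P i).integrand = fun z => (∏ j : Fin (b i), (z (Fin.castAdd (d i) j).succ.succ)⁻¹) * (ρ i).integrand (fun l : Fin (d i) => z (Fin.natAdd (b i) l).succ.succ)) → (∀ j, KZ.IsDominatedFamily (R j) (r₀ j) (g j)) → H = (∑ i, m i • KZ.of (P i)) + (∑ j, m₂ j • KZ.of (R j)) → ∀ s ∈ Set.Ioo (0 : ℝ) 1, KZ.sliceEval (∑ i, m i • KZ.of (P i)) s = 0 := by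
  intro h2a h2b H hH k m p q b d ρ P k₂ d₂ m₂ R r₀ g hP hR hHeq
  subst hHeq
  -- exponents and weights of the divergent monomials of the elementary net `D := ∑ i, m i • [P i]`
  obtain ⟨a, ha⟩ : ∃ a : Fin k → ℝ, ∀ i, a i = -((p i : ℝ) / (q i : ℝ)) :=
    ⟨fun i => -((p i : ℝ) / (q i : ℝ)), fun _ => rfl⟩
  obtain ⟨w, hw⟩ : ∃ w : Fin k → ℝ, ∀ i, w i = (m i : ℝ) * (-1) ^ (b i) * (ρ i).value :=
    ⟨fun i => (m i : ℝ) * (-1) ^ (b i) * (ρ i).value, fun _ => rfl⟩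
  -- (i) the slices of `D` on `(0,1)`: ONE finite sum of divergent monomials (additivity, S2a)
  have hD : ∀ s ∈ Ioo (0 : ℝ) 1, KZ.sliceEval (∑ i, m i • KZ.of (P i)) s =
      ∑ i, w i * s ^ (a i) * Real.log s ^ (b i) := by
    intro s hs
    simp only [map_sum, map_zsmul, KZ.sliceEval_of, Finset.sum_apply, Pi.smul_apply]
    simp only [zsmul_eq_mul]
    refine Finset.sum_congr rfl fun i _ => ?_
    obtain ⟨hq, -, hdom, hint⟩ := hP i
    rw [h2a (p i) (q i) (b i) (d i) (ρ i) (P i) hq hdom hint s hs, neg_eq_neg_one_mul (Real.log s),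
      mul_pow, ha, hw]
    ring
  have hdiv : ∀ i, a i < 0 ∨ (a i = 0 ∧ 0 < b i) := by
    intro i
    obtain ⟨hq, hpb, -, -⟩ := hP i
    rcases Nat.eq_zero_or_pos (p i) with hp | hp
    · refine Or.inr ⟨?_, hpb.resolve_left (by omega)⟩
      rw [ha, hp, Nat.cast_zero, zero_div, neg_zero]
    · refine Or.inl ?_
      rw [ha]
      exact neg_lt_zero.mpr (div_pos (Nat.cast_pos.mpr hp) (Nat.cast_pos.mpr hq))
  -- (ii) the slices of the dominated net `N := ∑ j, m₂ j • [R j]` converge as `s → 0⁺` (Lebesgue)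
  have hN : Tendsto (KZ.sliceEval (∑ j, m₂ j • KZ.of (R j))) (𝓝[>] 0)
      (𝓝 (∑ j, (m₂ j : ℝ) * (r₀ j).value)) := by
    have heq : KZ.sliceEval (∑ j, m₂ j • KZ.of (R j)) =
        fun s => ∑ j, (m₂ j : ℝ) * KZ.sliceValue (R j) s := by
      funext s
      simp only [map_sum, map_zsmul, KZ.sliceEval_of, Finset.sum_apply, Pi.smul_apply]
      simp only [zsmul_eq_mul]
    rw [heq]
    exact tendsto_finsetSum _ fun j _ => (hR j).tendsto_setIntegral.const_mul _
  -- (iii) the slices of the fibred relation `H = D + N` vanish a.e.: the set `A` of good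
  -- parameters is co-null, so `𝓝[>] 0 ⊓ 𝓟 A` is a non-trivial filter finer than `𝓝[>] 0`
  obtain ⟨A, hA⟩ : ∃ A : Set ℝ, A = {s : ℝ | KZ.sliceEval (∑ i, m i • KZ.of (P i)) s +
      KZ.sliceEval (∑ j, m₂ j • KZ.of (R j)) s = 0} := ⟨_, rfl⟩
  have hAc : volume Aᶜ = 0 := by
    rw [hA, compl_setOf]
    refine ae_iff.1 ?_
    filter_upwards [KZ.sliceEval_ae_eq_zero hH] with s hs
    simpa only [map_add, Pi.add_apply, Pi.zero_apply] using hs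
  have hl := nhdsGT_inf_principal_neBot_of_volume_compl_eq_zero hAc
  have hle : 𝓝[>] (0 : ℝ) ⊓ 𝓟 A ≤ 𝓝[>] (0 : ℝ) := inf_le_left
  -- (iv) along it the monomial sum tends to `-(∑ j, m₂ j * (r₀ j).value)`, and (S2b) applies
  have key : Tendsto (fun s : ℝ => ∑ i, w i * s ^ (a i) * Real.log s ^ (b i))
      (𝓝[>] (0 : ℝ) ⊓ 𝓟 A) (𝓝 (-(∑ j, (m₂ j : ℝ) * (r₀ j).value))) := by
    refine ((hN.mono_left hle).neg).congr' ?_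
    have h1 : ∀ᶠ s in 𝓝[>] (0 : ℝ) ⊓ 𝓟 A, s ∈ A := mem_inf_of_right (mem_principal_self _)
    have h2 : ∀ᶠ s in 𝓝[>] (0 : ℝ) ⊓ 𝓟 A, s ∈ Ioo (0 : ℝ) 1 :=
      mem_inf_of_left (Ioo_mem_nhdsGT one_pos)
    filter_upwards [h1, h2] with s hs1 hs2
    rw [hA, mem_setOf_eq, hD s hs2] at hs1
    linarith
  have hcoef := h2b k a b w _ _ hl hle hdiv key
  -- (v) at the given parameter, group the monomial sum by exponent pairs `(a i, b i)`: every
  -- group carries total coefficient `0`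
  intro s hs
  rw [hD s hs]
  have hgroup : ∀ i₀ : Fin k, ∑ j ∈ Finset.univ.filter (fun j => (a j, b j) = (a i₀, b i₀)),
      w j * s ^ (a j) * Real.log s ^ (b j) = 0 := by
    intro i₀
    calc ∑ j ∈ Finset.univ.filter (fun j => (a j, b j) = (a i₀, b i₀)),
          w j * s ^ (a j) * Real.log s ^ (b j)
        = ∑ j ∈ Finset.univ.filter (fun j => a j = a i₀ ∧ b j = b i₀),
            w j * (s ^ (a i₀) * Real.log s ^ (b i₀)) := by
          refine Finset.sum_congr ?_ fun j hj => ?_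
          · ext j
            simp only [Finset.mem_filter, Finset.mem_univ, true_and, Prod.mk.injEq]
          · obtain ⟨-, hja, hjb⟩ := Finset.mem_filter.1 hj
            rw [hja, hjb, mul_assoc]
      _ = 0 := by rw [← Finset.sum_mul, hcoef i₀, zero_mul]
  have himg := Finset.sum_image' (s := Finset.univ) (g := fun i => (a i, b i))
    (f := fun _ => (0 : ℝ)) (fun i => w i * s ^ (a i) * Real.log s ^ (b i))
    fun i₀ _ => (hgroup i₀).symm
  rw [Finset.sum_const_zero] at himg
  exact himg.symm

end Summit.KontsevichZagierPeriods.ValuedFieldSpecialisation
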